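import Literature.NumberTheory.NumberFields.BhargavaQuinticSpace
import Mathlib.LinearAlgebra.Matrix.Transvection
import Mathlib.LinearAlgebra.Matrix.Adjugate
import HarnessLib

/-!
# Bhargava's quintic space: covariance of the sub-Pfaffians and transport of `K(A)` along orbits

Support file for the named fact
`Literature.NumberTheory.NumberFields.BhargavaQuinticSpace.WrightYukie1992_orbit_bijective_etaleQuintic`
(file `BhargavaQuinticSpace.lean`).  Everything here is PROVED:

* the explicit components of the vector `Q(X) = (Q₁, …, Q₅)` of signed `4 × 4` sub-Pfaffians of a
  `5 × 5` matrix (`subPfVec_apply_zero`, …), and the normal form `altFive` of an alternating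
  `5 × 5` matrix;
* **Bhargava's covariance identity** [Bhargava2008, (8) p. 63]: for an alternating `X` and any
  `γ ∈ M₅(K)` over a field, `Q(γ X γᵀ) ᵥ* γ = det γ • Q(X)` (`subPfVec_conj_vecMul`), hence for
  invertible `γ`, `Q(γ X γᵀ) = det γ • Q(X) ᵥ* γ⁻¹` (`subPfVec_conj`, the printed form
  "`Q(γ A γᵀ) = det γ · (γ⁻¹)ᵀ Q(A)`") and `Q(γ X γᵀ) = 0 ↔ Q(X) = 0`.  Proof: both sides are
  multiplicative in `γ`, so by `Matrix.diagonal_transvection_induction` it suffices to treat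
  diagonal matrices (uniform computation) and transvections (a finite case check);
* the pencil under the action: `(g • A)(t) = g₅ · A(t ᵥ* g₄) · g₅ᵀ` (`pencil_gl_smul`), so the
  five quadrics of `g • A` vanish at `t` iff those of `A` vanish at `t ᵥ* g₄`
  (`forall_subPfaffian_smul_eq_zero_iff`); base change commutes with the action (`map_smul`);
* over a field `k`: the zero locus transports along the `k`-rational projective transformation
  `glFourProj g₄ : [v] ↦ [v ᵥ* g₄]` (`mem_geomZeroLocus_smul_iff`), which commutes with
  `Gal(k̄/k)` (`galAct_glFourProj`); whence the bijection `zeroLocusSmulEquiv : Z_{g•A} ≃ Z_A` and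
  the `k`-algebra isomorphism `quinticAlgebraOfSmulEquiv : K(A) ≃ₐ[k] K(g • A)`;
* **part (b), direction ⟹, of the fact**: `nonempty_algEquiv_of_smul_eq` — points of `V(k)` in
  the same `GL₄(k) × GL₅(k)`-orbit have isomorphic quintic algebras
  [Yukie1993, §0.4 Thm (0.4.2), "only if"; Bhargava2008, §2].

## References

* M. Bhargava, *Higher composition laws IV*, Ann. of Math. 167 (2008), 53–94, (8) p. 63. [Bhargava2008]
* A. Yukie, *Shintani Zeta Functions*, LMS LNS 183, CUP (1993), §0.4 Thm (0.4.2). [Yukie1993]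
-/

noncomputable section

open Matrix
open scoped LinearAlgebra.Projectivization

namespace Literature.NumberTheory.NumberFields
namespace BhargavaQuinticSpace

universe u

variable {R : Type*} [CommRing R]

/-! ### Explicit components of `Q(X)` -/

/-- `Q₁(X) = x₂₃x₄₅ - x₂₄x₃₅ + x₂₅x₃₄` (indices shifted to `0,…,4`). [cite: Bhargava2008, (8) p. 63] -/
theorem subPfVec_apply_zero (X : Matrix (Fin 5) (Fin 5) R) :
    subPfVec X 0 = X 1 2 * X 3 4 - X 1 3 * X 2 4 + X 1 4 * X 2 3 := by
  simp [subPfVec, pf4]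

/-- `Q₂(X) = -(x₁₃x₄₅ - x₁₄x₃₅ + x₁₅x₃₄)` (indices shifted to `0,…,4`). [cite: Bhargava2008, (8) p. 63] -/
theorem subPfVec_apply_one (X : Matrix (Fin 5) (Fin 5) R) :
    subPfVec X 1 = -(X 0 2 * X 3 4 - X 0 3 * X 2 4 + X 0 4 * X 2 3) := by
  simp [subPfVec, pf4, Fin.succAbove, Fin.lt_def]

/-- `Q₃(X) = x₁₂x₄₅ - x₁₄x₂₅ + x₁₅x₂₄` (indices shifted to `0,…,4`). [cite: Bhargava2008, (8) p. 63] -/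
theorem subPfVec_apply_two (X : Matrix (Fin 5) (Fin 5) R) :
    subPfVec X 2 = X 0 1 * X 3 4 - X 0 3 * X 1 4 + X 0 4 * X 1 3 := by
  simp [subPfVec, pf4, Fin.succAbove, Fin.lt_def]

/-- `Q₄(X) = -(x₁₂x₃₅ - x₁₃x₂₅ + x₁₅x₂₃)` (indices shifted to `0,…,4`). [cite: Bhargava2008, (8) p. 63] -/
theorem subPfVec_apply_three (X : Matrix (Fin 5) (Fin 5) R) :
    subPfVec X 3 = -(X 0 1 * X 2 4 - X 0 2 * X 1 4 + X 0 4 * X 1 2) := by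
  simp [subPfVec, pf4, Fin.succAbove, Fin.lt_def]
  ring

/-- `Q₅(X) = x₁₂x₃₄ - x₁₃x₂₄ + x₁₄x₂₃` (indices shifted to `0,…,4`). [cite: Bhargava2008, (8) p. 63] -/
theorem subPfVec_apply_four (X : Matrix (Fin 5) (Fin 5) R) :
    subPfVec X 4 = X 0 1 * X 2 3 - X 0 2 * X 1 3 + X 0 3 * X 1 2 := by
  simp [subPfVec, pf4, Fin.succAbove, Fin.lt_def]
  ring

/-- The alternating `5 × 5` matrix with prescribed entries `a, b, c, d, e, f, g, p, q, r` above the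
diagonal (row by row): the general element of `∧² R⁵` in the matrix model. [folklore] -/
def altFive (a b c d e f g p q r : R) : Matrix (Fin 5) (Fin 5) R :=
  !![0, a, b, c, d; -a, 0, e, f, g; -b, -e, 0, p, q; -c, -f, -p, 0, r; -d, -g, -q, -r, 0]

/-- An alternating `5 × 5` matrix is `altFive` of its ten entries above the diagonal. [folklore] -/
theorem eq_altFive_of_mem_altMatrix {X : Matrix (Fin 5) (Fin 5) R} (hX : X ∈ altMatrix (Fin 5) R) :
    X = altFive (X 0 1) (X 0 2) (X 0 3) (X 0 4) (X 1 2) (X 1 3) (X 1 4) (X 2 3) (X 2 4) (X 3 4) := by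
  ext a b
  fin_cases a <;> fin_cases b <;> simp [altFive] <;>
    first
    | exact hX.2 _
    | exact apply_swap_of_mem_altMatrix hX _ _

/-- The transpose of a transvection is a transvection. [folklore] -/
theorem transvection_transpose (i j : Fin 5) (c : R) :
    (transvection i j c)ᵀ = transvection j i c := by
  simp [transvection, transpose_add]

/-- Entries of `T X Tᵀ` for a transvection `T = 1 + c E_{ij}`: row `i` and column `i` pick up `c` times
row/column `j`. [folklore] -/
theorem transvection_conj_apply (i j : Fin 5) (c : R) (X : Matrix (Fin 5) (Fin 5) R)
    (a b : Fin 5) :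
    (transvection i j c * X * (transvection i j c)ᵀ) a b =
      X a b + (if a = i then c * X j b else 0) + (if b = i then c * X a j else 0) +
        (if a = i ∧ b = i then c * c * X j j else 0) := by
  rw [transvection_transpose]
  by_cases ha : a = i
  · subst ha
    by_cases hb : b = a
    · subst hb
      simp
      ring
    · simp [hb]
  · by_cases hb : b = i
    · subst hb
      simp [ha]
    · simp [ha, hb]

/-- `v ᵥ* (1 + c E_{ij}) = v + c vᵢ eⱼ`. [folklore] -/
theorem vecMul_transvection {n : Type*} [Fintype n] [DecidableEq n] (v : n → R) (i j : n) (c : R) :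
    v ᵥ* transvection i j c = v + Pi.single j (c * v i) := by
  ext m
  simp only [transvection, vecMul_add, vecMul_one, Pi.add_apply, add_right_inj]
  simp [Matrix.vecMul, dotProduct, Matrix.single_apply, Pi.single_apply, ite_and, Finset.sum_ite_eq,
    eq_comm, mul_comm]

/-- Covariance of `Q` under a transvection, explicit alternating matrix (a finite case check over
the `20` transvection types and `5` components). [cite: Bhargava2008, (8) p. 63] -/
theorem subPfVec_transvection_conj_altFive (i j : Fin 5) (hij : i ≠ j) (c a b cc d e f g p q r : R) :
    subPfVec (transvection i j c * altFive a b cc d e f g p q r * (transvection i j c)ᵀ) ᵥ*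
        transvection i j c = subPfVec (altFive a b cc d e f g p q r) := by
  rw [vecMul_transvection]
  fin_cases i <;> fin_cases j <;> (first | exact absurd rfl hij | skip) <;>
  · ext m
    fin_cases m <;>
    simp [subPfVec_apply_zero, subPfVec_apply_one, subPfVec_apply_two, subPfVec_apply_three,
      subPfVec_apply_four, transvection_conj_apply, altFive] <;> ring

/-- Covariance of `Q` under a transvection `T`: `Q(T X Tᵀ) ᵥ* T = Q(X)` (`det T = 1`).
[cite: Bhargava2008, (8) p. 63] -/
theorem subPfVec_transvection_conj (i j : Fin 5) (hij : i ≠ j) (c : R)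
    {X : Matrix (Fin 5) (Fin 5) R} (hX : X ∈ altMatrix (Fin 5) R) :
    subPfVec (transvection i j c * X * (transvection i j c)ᵀ) ᵥ* transvection i j c = subPfVec X := by
  rw [eq_altFive_of_mem_altMatrix hX]
  exact subPfVec_transvection_conj_altFive i j hij c _ _ _ _ _ _ _ _ _ _

/-- Covariance of `Q` under a diagonal matrix `D`: `Q(D X D) ᵥ* D = det D • Q(X)`.
[cite: Bhargava2008, (8) p. 63] -/
theorem subPfVec_diagonal_conj (D : Fin 5 → R) (X : Matrix (Fin 5) (Fin 5) R) :
    subPfVec (diagonal D * X * (diagonal D)ᵀ) ᵥ* diagonal D = (∏ i, D i) • subPfVec X := by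
  ext m
  rw [Fin.prod_univ_succAbove D m]
  simp [vecMul_diagonal, subPfVec, pf4, Fin.prod_univ_four]
  ring

/-- **Bhargava's covariance identity, determinant form.** For an alternating `5 × 5` matrix `X` over a
field and ANY `γ`, `Q(γ X γᵀ) ᵥ* γ = det γ • Q(X)` (i.e. `Q` is a covariant of type `∧⁴ = det ⊗ (std)∨`).
Proof by `Matrix.diagonal_transvection_induction`. [cite: Bhargava2008, (8) p. 63] -/
theorem subPfVec_conj_vecMul {K : Type*} [Field K] (h : Matrix (Fin 5) (Fin 5) K)
    {X : Matrix (Fin 5) (Fin 5) K} (hX : X ∈ altMatrix (Fin 5) K) :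
    subPfVec (h * X * hᵀ) ᵥ* h = h.det • subPfVec X := by
  revert X
  apply diagonal_transvection_induction
    (fun h : Matrix (Fin 5) (Fin 5) K => ∀ {X : Matrix (Fin 5) (Fin 5) K},
      X ∈ altMatrix (Fin 5) K → subPfVec (h * X * hᵀ) ᵥ* h = h.det • subPfVec X) h
  · intro D _ X hX
    rw [det_diagonal]
    exact subPfVec_diagonal_conj D X
  · rintro ⟨i, j, hij, c⟩ X hX
    rw [TransvectionStruct.toMatrix_mk, det_transvection_of_ne _ _ hij, one_smul]
    exact subPfVec_transvection_conj i j hij c hX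
  · intro A B hA hB X hX
    have hBX : B * X * Bᵀ ∈ altMatrix (Fin 5) K := conj_mem_altMatrix B hX
    have e : A * B * X * (A * B)ᵀ = A * (B * X * Bᵀ) * Aᵀ := by
      simp only [transpose_mul, Matrix.mul_assoc]
    rw [e, ← vecMul_vecMul, hA hBX, smul_vecMul, hB hX, det_mul, smul_smul]


/-- **Bhargava's identity (8)**, printed form: for invertible `γ`,
`Q(γ X γᵀ) = det γ · Q(X) ᵥ* γ⁻¹` (`= det γ · (γ⁻¹)ᵀ Q(X)` as a column vector).
[cite: Bhargava2008, (8) p. 63] -/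
theorem subPfVec_conj {K : Type*} [Field K] (h : Matrix (Fin 5) (Fin 5) K) (hh : IsUnit h.det)
    {X : Matrix (Fin 5) (Fin 5) K} (hX : X ∈ altMatrix (Fin 5) K) :
    subPfVec (h * X * hᵀ) = h.det • (subPfVec X ᵥ* h⁻¹) := by
  have e := congrArg (fun v => v ᵥ* h⁻¹) (subPfVec_conj_vecMul h hX)
  simpa only [vecMul_vecMul, mul_nonsing_inv _ hh, vecMul_one, smul_vecMul] using e

/-- For invertible `γ`, all `4 × 4` sub-Pfaffians of `γ X γᵀ` vanish iff those of `X` do.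
[cite: Bhargava2008, (8) p. 63] -/
theorem subPfVec_conj_eq_zero_iff {K : Type*} [Field K] (h : Matrix (Fin 5) (Fin 5) K)
    (hh : IsUnit h.det) {X : Matrix (Fin 5) (Fin 5) K} (hX : X ∈ altMatrix (Fin 5) K) :
    subPfVec (h * X * hᵀ) = 0 ↔ subPfVec X = 0 := by
  rw [subPfVec_conj h hh hX, smul_eq_zero, or_iff_right hh.ne_zero]
  constructor
  · intro h0
    have e := congrArg (fun v => v ᵥ* h) h0
    simpa only [vecMul_vecMul, nonsing_inv_mul _ hh, vecMul_one, zero_vecMul] using e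
  · intro h0
    rw [h0, zero_vecMul]

/-! ### The pencil under the group action -/

/-- `A(t) = ∑ tᵢ Aᵢ` is alternating. [folklore] -/
theorem pencil_mem_altMatrix (x : BhargavaQuinticSpace R) (t : Fin 4 → R) :
    pencil x t ∈ altMatrix (Fin 5) R :=
  Submodule.sum_mem _ fun i _ => Submodule.smul_mem _ _ (x i).2

/-- The `GL₄`-part acts on the pencil by the linear substitution `t ↦ t ᵥ* g₄`:
`(g₄ • A)(t) = A(t ᵥ* g₄)`. [cite: Bhargava2008, §2 p. 62] -/
theorem pencil_glFourAct (g : Matrix (Fin 4) (Fin 4) R) (x : BhargavaQuinticSpace R) (t : Fin 4 → R) :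
    pencil (glFourAct g x) t = pencil x (t ᵥ* g) := by
  simp only [pencil, glFourAct_apply, AddSubmonoidClass.coe_finsetSum, SetLike.val_smul,
    Finset.smul_sum, smul_smul, vecMul, dotProduct, Finset.sum_smul]
  rw [Finset.sum_comm]

/-- The `GL₅`-part acts on the pencil by `A(t) ↦ g₅ A(t) g₅ᵀ`. [cite: Bhargava2008, §2 p. 62] -/
theorem pencil_glFiveAct (h : Matrix (Fin 5) (Fin 5) R) (x : BhargavaQuinticSpace R) (t : Fin 4 → R) :
    pencil (glFiveAct h x) t = h * pencil x t * hᵀ := by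
  simp [pencil, glFiveAct_apply, Finset.mul_sum, Finset.sum_mul]

/-- The pencil of `g • A`: `(g • A)(t) = g₅ · A(t ᵥ* g₄) · g₅ᵀ`. [cite: Bhargava2008, §2 p. 62] -/
theorem pencil_gl_smul (g : GL (Fin 4) R × GL (Fin 5) R) (x : BhargavaQuinticSpace R) (t : Fin 4 → R) :
    pencil (g • x) t =
      (g.2 : Matrix (Fin 5) (Fin 5) R) * pencil x (t ᵥ* (g.1 : Matrix (Fin 4) (Fin 4) R)) *
        (g.2 : Matrix (Fin 5) (Fin 5) R)ᵀ := by
  rw [smul_def, pencil_glFourAct, pencil_glFiveAct]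

/-- `(Q₁(A)(t), …, Q₅(A)(t)) = Q(A(t))`. [folklore] -/
theorem subPfaffian_eq_subPfVec (x : BhargavaQuinticSpace R) (t : Fin 4 → R) :
    (fun m => subPfaffian x m t) = subPfVec (pencil x t) := rfl

/-- Over a field, the five quadrics of `g • A` vanish at `t` iff those of `A` vanish at `t ᵥ* g₄`
(the `GL₅`-part does not move the zero locus, by the covariance identity). [cite: Bhargava2008, (8) p. 63 and §2 p. 62] -/
theorem forall_subPfaffian_smul_eq_zero_iff {K : Type*} [Field K] (g : GL (Fin 4) K × GL (Fin 5) K)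
    (x : BhargavaQuinticSpace K) (t : Fin 4 → K) :
    (∀ m, subPfaffian (g • x) m t = 0) ↔
      ∀ m, subPfaffian x m (t ᵥ* (g.1 : Matrix (Fin 4) (Fin 4) K)) = 0 := by
  have h1 : (∀ m, subPfaffian (g • x) m t = 0) ↔ subPfVec (pencil (g • x) t) = 0 :=
    ⟨fun h => funext h, fun h m => congrFun h m⟩
  have h2 : (∀ m, subPfaffian x m (t ᵥ* (g.1 : Matrix (Fin 4) (Fin 4) K)) = 0) ↔
      subPfVec (pencil x (t ᵥ* (g.1 : Matrix (Fin 4) (Fin 4) K))) = 0 :=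
    ⟨fun h => funext h, fun h m => congrFun h m⟩
  rw [h1, h2, pencil_gl_smul,
    subPfVec_conj_eq_zero_iff _ (isUnits_det_units g.2) (pencil_mem_altMatrix _ _)]

/-! ### Base change commutes with the action -/

/-- The matrix of `GLₙ(f) g` is the entrywise image of the matrix of `g`. [folklore] -/
theorem coe_generalLinearGroup_map {n : Type*} [Fintype n] [DecidableEq n] {S : Type*} [CommRing S]
    (f : R →+* S) (g : GL n R) :
    ((Matrix.GeneralLinearGroup.map f g : GL n S) : Matrix n n S) = (g : Matrix n n R).map f :=
  rfl

/-- Base change `V(R) → V(S)` commutes with the `GL₄ × GL₅`-action. [folklore] -/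
theorem map_smul {S : Type*} [CommRing S] (f : R →+* S) (g : GL (Fin 4) R × GL (Fin 5) R)
    (x : BhargavaQuinticSpace R) :
    map f (g • x) =
      ((Matrix.GeneralLinearGroup.map f g.1, Matrix.GeneralLinearGroup.map f g.2) :
        GL (Fin 4) S × GL (Fin 5) S) • map f x := by
  have key : ∀ F : Fin 4 → Matrix (Fin 5) (Fin 5) R, (∑ j, F j).map ⇑f = ∑ j, (F j).map ⇑f :=
    fun F => map_sum (f.mapMatrix : Matrix (Fin 5) (Fin 5) R →+* Matrix (Fin 5) (Fin 5) S) F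
      Finset.univ
  funext i
  apply Subtype.ext
  simp only [coe_map_apply, coe_smul_apply, coe_generalLinearGroup_map]
  rw [key]
  refine Finset.sum_congr rfl fun j _ => ?_
  rw [Matrix.map_smul' _ _ _ (map_mul f), Matrix.map_mul, Matrix.map_mul, Matrix.transpose_map]
  rfl

/-! ### Over a field: transport of the zero locus and of the quintic algebra -/

section Field

variable (k : Type u) [Field k]

/-- Base change `GLₙ(k) → GLₙ(k̄)` of a group element. [folklore] -/
abbrev glBaseChange {n : Type*} [Fintype n] [DecidableEq n] (g : GL n k) : GL n (AlgebraicClosure k) :=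
  Matrix.GeneralLinearGroup.map (algebraMap k (AlgebraicClosure k)) g

/-- Base change to `k̄` commutes with the action of `GL₄(k) × GL₅(k)`. [folklore] -/
theorem baseChange_smul (g : GL (Fin 4) k × GL (Fin 5) k) (x : BhargavaQuinticSpace k) :
    baseChange k (g • x) =
      ((glBaseChange k g.1, glBaseChange k g.2) :
        GL (Fin 4) (AlgebraicClosure k) × GL (Fin 5) (AlgebraicClosure k)) • baseChange k x :=
  map_smul _ g x

/-- The `k`-rational projective transformation `[v] ↦ [v ᵥ* g]` of `ℙ³(k̄)` induced by `g ∈ GL₄(k)`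
(the change of variables `t ↦ t ᵥ* g₄` in the pencil, `pencil_glFourAct`). [folklore] -/
def glFourProj (g : GL (Fin 4) k) :
    ℙ (AlgebraicClosure k) (Fin 4 → AlgebraicClosure k) →
      ℙ (AlgebraicClosure k) (Fin 4 → AlgebraicClosure k) :=
  Projectivization.map
    (Matrix.vecMulLinear ((glBaseChange k g : GL (Fin 4) (AlgebraicClosure k)) :
      Matrix (Fin 4) (Fin 4) (AlgebraicClosure k)))
    (fun v w hvw => Matrix.vecMul_injective_of_isUnit (Units.isUnit (glBaseChange k g))
      (by simpa using hvw))

/-- `glFourProj g [v] = [v ᵥ* g]`. [folklore] -/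
theorem glFourProj_mk (g : GL (Fin 4) k) (v : Fin 4 → AlgebraicClosure k) (hv : v ≠ 0) :
    glFourProj k g (Projectivization.mk _ v hv) =
      Projectivization.mk _ (v ᵥ* ((glBaseChange k g : GL (Fin 4) (AlgebraicClosure k)) :
          Matrix (Fin 4) (Fin 4) (AlgebraicClosure k)))
        (fun h0 => hv (Matrix.vecMul_injective_of_isUnit (Units.isUnit (glBaseChange k g))
          (by simpa using h0))) := by
  simp only [glFourProj, Projectivization.map_mk]
  rfl

/-- `glFourProj (g h) = glFourProj h ∘ glFourProj g` (a right action written on the left). [folklore] -/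
theorem glFourProj_mul (g h : GL (Fin 4) k) (p : ℙ (AlgebraicClosure k) (Fin 4 → AlgebraicClosure k)) :
    glFourProj k (g * h) p = glFourProj k h (glFourProj k g p) := by
  induction p using Projectivization.ind with
  | h v hv =>
    simp only [glFourProj_mk, glBaseChange, map_mul, Units.val_mul, vecMul_vecMul]

/-- `glFourProj 1 = id`. [folklore] -/
theorem glFourProj_one (p : ℙ (AlgebraicClosure k) (Fin 4 → AlgebraicClosure k)) :
    glFourProj k 1 p = p := by
  induction p using Projectivization.ind with
  | h v hv =>
    simp only [glFourProj_mk, glBaseChange, map_one, Units.val_one, vecMul_one]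

/-- `glFourProj g⁻¹ ∘ glFourProj g = id`. [folklore] -/
theorem glFourProj_inv_apply (g : GL (Fin 4) k) (p : ℙ (AlgebraicClosure k) (Fin 4 → AlgebraicClosure k)) :
    glFourProj k g⁻¹ (glFourProj k g p) = p := by
  rw [← glFourProj_mul, mul_inv_cancel, glFourProj_one]

/-- `glFourProj g ∘ glFourProj g⁻¹ = id`. [folklore] -/
theorem glFourProj_apply_inv (g : GL (Fin 4) k) (p : ℙ (AlgebraicClosure k) (Fin 4 → AlgebraicClosure k)) :
    glFourProj k g (glFourProj k g⁻¹ p) = p := by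
  rw [← glFourProj_mul, inv_mul_cancel, glFourProj_one]

/-- **Transport of the zero locus**: `p ∈ Z_{g • A}` iff `glFourProj g₄ p ∈ Z_A`, i.e.
`Z_{g•A} = g₄⁻¹ · Z_A` is a projective image of `Z_A`. [cite: Bhargava2008, §2 p. 62; Yukie1993, §0.4] -/
theorem mem_geomZeroLocus_smul_iff (g : GL (Fin 4) k × GL (Fin 5) k) (x : BhargavaQuinticSpace k)
    (p : ℙ (AlgebraicClosure k) (Fin 4 → AlgebraicClosure k)) :
    p ∈ geomZeroLocus k (g • x) ↔ glFourProj k g.1 p ∈ geomZeroLocus k x := by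
  induction p using Projectivization.ind with
  | h v hv =>
    rw [glFourProj_mk, mk_mem_geomZeroLocus_iff, mk_mem_geomZeroLocus_iff, baseChange_smul,
      forall_subPfaffian_smul_eq_zero_iff]

/-- The Galois action on `ℙ³(k̄)` commutes with `k`-rational projective transformations. [folklore] -/
theorem galAct_glFourProj (σ : AlgebraicClosure k ≃ₐ[k] AlgebraicClosure k) (g : GL (Fin 4) k)
    (p : ℙ (AlgebraicClosure k) (Fin 4 → AlgebraicClosure k)) :
    galAct k σ (glFourProj k g p) = glFourProj k g (galAct k σ p) := by
  induction p using Projectivization.ind with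
  | h v hv =>
    simp only [glFourProj_mk, galAct_mk]
    congr 1
    funext j
    simp [vecMul, dotProduct, map_sum, map_mul, AlgEquiv.commutes]

/-- The (Galois-equivariant) bijection `Z_{g • A}(k̄) ≃ Z_A(k̄)`, `p ↦ glFourProj g₄ p`. [folklore] -/
def zeroLocusSmulEquiv (g : GL (Fin 4) k × GL (Fin 5) k) (x : BhargavaQuinticSpace k) :
    geomZeroLocus k (g • x) ≃ geomZeroLocus k x where
  toFun p := ⟨glFourProj k g.1 p, (mem_geomZeroLocus_smul_iff k g x p).1 p.2⟩
  invFun q := ⟨glFourProj k g.1⁻¹ q, by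
    rw [mem_geomZeroLocus_smul_iff, glFourProj_apply_inv]
    exact q.2⟩
  left_inv p := Subtype.ext (glFourProj_inv_apply k g.1 p)
  right_inv q := Subtype.ext (glFourProj_apply_inv k g.1 q)

/-- Unfolding `zeroLocusSmulEquiv`. [folklore] -/
@[simp]
theorem coe_zeroLocusSmulEquiv (g : GL (Fin 4) k × GL (Fin 5) k) (x : BhargavaQuinticSpace k)
    (p : geomZeroLocus k (g • x)) :
    ((zeroLocusSmulEquiv k g x p : geomZeroLocus k x) : ℙ (AlgebraicClosure k) (Fin 4 → AlgebraicClosure k)) =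
      glFourProj k g.1 p :=
  rfl

/-- Unfolding `zeroLocusSmulEquiv.symm`. [folklore] -/
@[simp]
theorem coe_zeroLocusSmulEquiv_symm (g : GL (Fin 4) k × GL (Fin 5) k) (x : BhargavaQuinticSpace k)
    (q : geomZeroLocus k x) :
    (((zeroLocusSmulEquiv k g x).symm q : geomZeroLocus k (g • x)) :
        ℙ (AlgebraicClosure k) (Fin 4 → AlgebraicClosure k)) = glFourProj k g.1⁻¹ q :=
  rfl

/-- **Orbit ⟹ isomorphism.** The `k`-algebra isomorphism `K(A) ≃ₐ[k] K(g • A)` obtained by pulling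
back Galois-equivariant functions along the equivariant bijection `Z_{g•A} ≃ Z_A`.
[cite: Yukie1993, §0.4 Thm (0.4.2); Bhargava2008, §2 pp. 62–63] -/
def quinticAlgebraOfSmulEquiv (g : GL (Fin 4) k × GL (Fin 5) k) (x : BhargavaQuinticSpace k) :
    quinticAlgebraOf k x ≃ₐ[k] quinticAlgebraOf k (g • x) where
  toFun f := ⟨fun p => (f : geomZeroLocus k x → AlgebraicClosure k) (zeroLocusSmulEquiv k g x p), by
    intro σ p q hpq
    refine f.2 σ (zeroLocusSmulEquiv k g x p) (zeroLocusSmulEquiv k g x q) ?_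
    rw [coe_zeroLocusSmulEquiv, coe_zeroLocusSmulEquiv, galAct_glFourProj, hpq]⟩
  invFun f := ⟨fun q => (f : geomZeroLocus k (g • x) → AlgebraicClosure k) ((zeroLocusSmulEquiv k g x).symm q), by
    intro σ p q hpq
    refine f.2 σ ((zeroLocusSmulEquiv k g x).symm p) ((zeroLocusSmulEquiv k g x).symm q) ?_
    rw [coe_zeroLocusSmulEquiv_symm, coe_zeroLocusSmulEquiv_symm, galAct_glFourProj, hpq]⟩
  left_inv f := by
    ext q
    simp
  right_inv f := by
    ext p
    simp
  map_mul' f f' := by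
    ext p
    rfl
  map_add' f f' := by
    ext p
    rfl
  commutes' c := by
    ext p
    rfl

/-- **Part (b), direction ⟹, of `WrightYukie1992_orbit_bijective_etaleQuintic`**: elements of `V(k)`
in the same `GL₄(k) × GL₅(k)`-orbit have isomorphic quintic algebras `K(A) ≃ₐ[k] K(A')` (for every
field `k`, with no non-degeneracy hypothesis). [cite: Yukie1993, §0.4 Thm (0.4.2); Bhargava2008, §2] -/
theorem nonempty_algEquiv_of_smul_eq {x y : BhargavaQuinticSpace k} (g : GL (Fin 4) k × GL (Fin 5) k)
    (h : g • x = y) : Nonempty (quinticAlgebraOf k x ≃ₐ[k] quinticAlgebraOf k y) := by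
  subst h
  exact ⟨quinticAlgebraOfSmulEquiv k g x⟩

end Field

end BhargavaQuinticSpace
end Literature.NumberTheory.NumberFields
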